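import Summits.AtomisticToContinuum.HydrodynamicLimit.Theses.LindebergRandomFuture
import Summits.AtomisticToContinuum.HydrodynamicLimit.Theorems.LambertianContactSwapLambertianEulerOfHearts
import Summits.AtomisticToContinuum.HydrodynamicLimit.Theses.LambertianContactSwap
import Summits.AtomisticToContinuum.HydrodynamicLimit.Theorems.LambertianContactSwapLambertianEulerArchimedes
import Summits.AtomisticToContinuum.HydrodynamicLimit.Theorems.LambertianContactSwapLambertianEulerLambertLaw
import Summits.AtomisticToContinuum.HydrodynamicLimit.Theorems.LambertianContactSwapLambertianEulerPovzner
import Summits.AtomisticToContinuum.HydrodynamicLimit.Theorems.LambertianContactSwapLambertianEulerPairPovzner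
import Summits.AtomisticToContinuum.HydrodynamicLimit.Theorems.LambertianContactSwapLambertianEulerContactIsotropy
import Summits.AtomisticToContinuum.HydrodynamicLimit.Theorems.LambertianContactSwapLambertianEulerMomentLedgerChain
import Summits.AtomisticToContinuum.HydrodynamicLimit.Theorems.LambertianContactSwapLambertianEulerGibbsInvariance
import Summits.AtomisticToContinuum.HydrodynamicLimit.Theorems.LambertianContactSwapLambertianEulerEntropyToHydro
import Summits.AtomisticToContinuum.HydrodynamicLimit.Theorems.LambertianContactSwapLambertianEulerWindow
import Summits.AtomisticToContinuum.HydrodynamicLimit.Theorems.LambertianContactSwapLambertianEulerMarkov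
import Summits.AtomisticToContinuum.HydrodynamicLimit.Theorems.LambertianContactSwapLambertianEulerIterate
import Summits.AtomisticToContinuum.HydrodynamicLimit.Theorems.LambertianContactSwapLambertianEulerDock
import Summits.AtomisticToContinuum.HydrodynamicLimit.Theorems.LambertianContactSwapLambertianEulerKlLedger
import Summits.AtomisticToContinuum.HydrodynamicLimit.Theorems.LambertianContactSwapLambertianEulerLawSemigroup
import Summits.AtomisticToContinuum.HydrodynamicLimit.Theorems.LambertianContactSwapLambertianEulerDockRf
import Summits.AtomisticToContinuum.HydrodynamicLimit.Theorems.LambertianContactSwapLambertianEulerLambertDirMean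
import Summits.AtomisticToContinuum.HydrodynamicLimit.Theorems.LambertianContactSwapLambertianEulerPairMeanSq
import Summits.AtomisticToContinuum.HydrodynamicLimit.Theorems.LambertianContactSwapLambertianEulerPathwiseProduction
import Summits.AtomisticToContinuum.HydrodynamicLimit.Theorems.LambertianContactSwapLambertianEulerWindowLedger
import Summits.AtomisticToContinuum.HydrodynamicLimit.Theorems.LambertianContactSwapLambertianEulerCollisionCompensator
import Summits.AtomisticToContinuum.HydrodynamicLimit.Theorems.LambertianContactSwapLambertianEulerCompensatedJump
import Summits.AtomisticToContinuum.HydrodynamicLimit.Theorems.LambertianContactSwapLambertianEulerAprioriEntropyBound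
import Summits.AtomisticToContinuum.HydrodynamicLimit.Theorems.LambertianContactSwapLambertianEulerCollisionIntensity
import Summits.AtomisticToContinuum.HydrodynamicLimit.Theorems.LambertianContactSwapLambertianEulerTwoTimeLaw
import Summits.AtomisticToContinuum.HydrodynamicLimit.Theorems.LambertianContactSwapLambertianEulerCollisionBudget
import Summits.AtomisticToContinuum.HydrodynamicLimit.Theorems.LambertianContactSwapLambertianEulerExpectedWindowProductionTools
import Summits.AtomisticToContinuum.HydrodynamicLimit.Theorems.LambertianContactSwapLambertianEulerExpectedWindowProduction
import Summits.AtomisticToContinuum.HydrodynamicLimit.Theorems.LambertianContactSwapLambertianEulerProductionSplit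
import Summits.AtomisticToContinuum.HydrodynamicLimit.Theorems.TwoClocksClampedEntropyClockTimeZeroReference
import Summits.AtomisticToContinuum.HydrodynamicLimit.Theorems.TwoClocksClampedEntropyClockDiscreteEntropyGronwall
import Summits.AtomisticToContinuum.HydrodynamicLimit.Theorems.TwoClocksClampedEntropyClockKlDivLawAtLocalGibbsNeTop
import Literature.MathematicalPhysics.KineticTheory.LambertianRedrawNondegenerate
import Literature.MathematicalPhysics.KineticTheory.Hilbert6Wave0Proofs
import Literature.MathematicalPhysics.KineticTheory.HardSphereEulerLLN
import Literature.Barriers.AtomisticToContinuum.HighMomentumCutoff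
import Literature.Analysis.FluidPDE.HardSphereAlexander
import HarnessLib

/-! TTRL-lite variant V13069 of stmt-AtomisticToContinuum-11854 -/

namespace Summit.AtomisticToContinuum.HydrodynamicLimit.Theorems

open scoped BigOperators Topology ENNReal InnerProductSpace
open MeasureTheory ProbabilityTheory Filter Set InformationTheory
open Literature.MathematicalPhysics.KineticTheory
open Literature.Analysis.FluidPDE Literature.Analysis.FluidPDE.Alexander
open Summit.AtomisticToContinuum.HydrodynamicLimit.Theses.LambertianContactSwap
open Summit.AtomisticToContinuum.HydrodynamicLimit.Theorems.ClampedCurrentsDockPathwise (gSum DgSum)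

/-- **TTRL-lite variant V13069** (EOS `have` of `stub_diluteSelfConsistency`,
stmt-AtomisticToContinuum-11854): the hard-sphere compressibility factor is an `O(η)` perturbation
of the ideal gas near zero packing fraction — there are `δ > 0` and `C` with
`|Z(η) − 1| ≤ C η` for `η ∈ [0, δ]`. From the proved low-density equation of state
`hsEosLowDensity_proof` (`f_ex = F` on `[0, η₀)`, `F` analytic on `(−η₀, η₀)`): on `(0, η₀)`,
`Z(η) = 1 + η F'(η)` (`hsCompressibility_eq`), and `F'` is continuous hence bounded by some `C` on
the compact `[0, η₀/2]`; so `|Z(η) − 1| = η |F'(η)| ≤ C η` there, and both sides vanish at `η = 0`. -/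
theorem stub_diluteSelfConsistency_var13069 :
    ∃ δ : ℝ, 0 < δ ∧ ∃ C : ℝ, ∀ η ∈ Set.Icc (0 : ℝ) δ, |hsCompressibility η - 1| ≤ C * η := by
  obtain ⟨η₀, hη₀, F, hFa, hF, -, -, -⟩ :=
    Summit.AtomisticToContinuum.HydrodynamicLimit.Theorems.hsEosLowDensity_proof
  -- `F'` is continuous on the compact `[0, η₀/2]`, hence bounded there
  have hcont : ContinuousOn (deriv F) (Set.Icc 0 (η₀ / 2)) := by
    have hsub : Set.Icc 0 (η₀ / 2) ⊆ Set.Ioo (-η₀) η₀ := fun x hx =>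
      ⟨by linarith [hx.1], by linarith [hx.2]⟩
    exact hFa.deriv.continuousOn.mono hsub
  obtain ⟨C, hC⟩ := isCompact_Icc.exists_bound_of_continuousOn hcont
  refine ⟨η₀ / 2, by positivity, C, fun η hη => ?_⟩
  rcases hη.1.eq_or_lt with h0 | hpos
  · subst h0
    simp [hsCompressibility]
  have hηo : η ∈ Set.Ioo 0 η₀ := ⟨hpos, by linarith [hη.2]⟩
  rw [hsCompressibility_eq hF hηo, add_sub_cancel_left, abs_mul, abs_of_pos hpos]
  have h := hC η hη
  rw [Real.norm_eq_abs] at h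
  calc η * |deriv F η| ≤ η * C := mul_le_mul_of_nonneg_left h hη.1
    _ = C * η := mul_comm _ _

end Summit.AtomisticToContinuum.HydrodynamicLimit.Theorems
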